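import Mathlib.RingTheory.Valuation.LocalSubring
import Mathlib.FieldTheory.PurelyInseparable.Basic
import Mathlib.FieldTheory.PrimitiveElement
import Mathlib.Algebra.Polynomial.Lifts
import Mathlib.RingTheory.Nullstellensatz
import Literature.NumberTheory.EllipticCurves.IsogenyDegreeProofs
import Literature.NumberTheory.EllipticCurves.FunctionFieldTranslation
import Literature.NumberTheory.DiophantineGeometry.WeierstrassFunctionFieldPlaces
import Literature.NumberTheory.DiophantineGeometry.FunctionFieldGenusWeierstrassProofs
import Literature.NumberTheory.DiophantineGeometry.FunctionFieldGenusEllZeroProofs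
import HarnessLib

/-!
# Silverman, *AEC*, Thm. III.4.10(a): `#ker φ = deg_s φ` (proof of `card_ker_eq_finSepDegree`)

Trunk T-ELLARITH (group G16); notion `cm_endomorphisms_isogeny`. Sibling file of
`Literature.NumberTheory.EllipticCurves.IsogenyDegree` (D-0014 append protocol): it **proves**
the named fact `WeierstrassCurve.Isogeny.card_ker_eq_finSepDegree W W'` vendored there —
Silverman, *The Arithmetic of Elliptic Curves*, Thm. III.4.10(a) at `Q = O`: for a non-zero
isogeny `φ : E → E'` of elliptic curves, `#ker φ = deg_s φ`, the separable degree
`[K̄(E) : φ^* K̄(E')]_s` — for the prelude's isogenies (`Literature.NumberTheory.EllipticCurves.Isogeny`: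
additive maps on `K̄`-points agreeing with a rational map off a finite set) and the genuine
`φ^* K̄(E') = Isogeny.pullbackField φ ⊆ K̄(E)` of `IsogenyDegree`:
`WeierstrassCurve.Isogeny.card_ker_eq_finSepDegree_holds`.

## The printed proof and the proof given here

Silverman (pp. 72–73) proves (a) from Prop. II.2.6(b) — *`#φ⁻¹(Q) = deg_s φ` for all but
finitely many `Q`*, for which he cites Hartshorne II.6.8 — and the homogeneity of `φ` (all fibres
are translates of `ker φ`), and then (b): `T ↦ τ_T^*` is an injective homomorphism
`ker φ → Aut(K̄(E₁)/φ^* K̄(E₂))`, a group of order `≤ deg_s φ`. Here the two inequalities are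
proved separately, with `L = K̄(E)`, `F = φ^* K̄(E')`:

* **`#ker φ ≤ [L : F]_s`** (`Isogeny.card_ker_le_finSepDegree`): the tree's
  `Literature.NumberTheory.EllipticCurves.FunctionFieldTranslation` provides the injective
  translation homomorphism `transHom : E(K̄) → Aut(L/K̄)` and shows that the translations by
  kernel points fix `F` (`Isogeny.pullbackField_le_fixedField`, Silverman's
  "`τ_T^* φ^* = (φ ∘ τ_T)^* = φ^*`"); so `ker φ` injects into `Aut(L/F)`, which injects into the
  `F`-embeddings of `L` into an algebraic closure, `[L : F]_s` in number (Mathlib's definition of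
  `Field.finSepDegree`).
* **`[L : F]_s ≤ #ker φ`** (`Isogeny.finSepDegree_le_card_ker`), the part resting on II.2.6(b),
  through the places (discrete valuation rings) of `L/K̄`, which the tree identifies with the
  points of `E` (`Literature.NumberTheory.DiophantineGeometry.WeierstrassFunctionFieldPlaces`:
  every place is the place at infinity or the local ring at a maximal ideal of the Dedekind domain
  `K̄[E]`; plus the Nullstellensatz `exists_maxIdealAt_eq` below: maximal ideals of `K̄[E]` are
  affine points). The field-theoretic core is `Literature.NumberTheory.EllipticCurves.SeparableDegreePlaces.exists_finset_card_le_places`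
  (section `Literature.SeparableDegreePlaces`, Mathlib only): *for a finite extension `L/F` there is a
  finite `B ⊆ F` such that every valuation ring `O ≠ F` of `F` containing `B`, with residue
  field an algebraically closed subfield `k ⊆ O`, has at least `[L : F]_s` distinct places of `L`
  above it* (Dedekind–Kummer at one good prime: a primitive element `α` of the separable closure,
  its minimal polynomial `m` with `a m + b m' = 1`, `B` = coefficients of `m, a, b`; the reduction
  of `m` has `[L : F]_s` distinct roots `ρᵢ ∈ k`, each ideal `(𝔪_O, α - ρᵢ)` of `O[α]` is proper,
  and Chevalley's extension theorem, Mathlib's `Ideal.image_subset_nonunits_valuationSubring`,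
  puts a valuation ring of `L` above it). Applied to `F = φ^* K̄(E')` and the place `O` of `F`
  below the place of `L` at a generic point `P₀ ∈ E(K̄)` (generic: off a finite set, `E(K̄)` being
  infinite), with `Q = φ P₀`: `O` is a proper valuation ring (`L/F` is algebraic, *AEC* II.2.4(a),
  `IsogenyDegreeProofs`), contains `B` (the elements of `B`, read in `K̄(E')`, are regular at the
  generic `Q`), and has residue field `K̄`; the `[L : F]_s` places above it are places of points
  `Pᵢ ∈ E(K̄)`, and each `Pᵢ` lies in the fibre `φ⁻¹(Q)`, because the place of `L` at a point of
  agreement `P` lies above the place of `K̄(E')` at `φ P` (`Isogeny.comap_pullbackHom_place`: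
  `f` regular at `φ P` ⇒ `φ^* f` regular at `P`) and the generic `Q` is not below the place of any
  exceptional point. Hence `[L : F]_s ≤ #φ⁻¹(Q) = #ker φ`.

## Contents (all definitions are real)

* `Literature.SeparableDegreePlaces.HasResidueField O j` (the residue field of the valuation ring `O` is
  the subfield `j : k → F`), its residue map `HasResidueField.res : O →+* k`, and
  `exists_finset_card_le_places` (above); small lemmas on `ValuationSubring.nonunits`.
* `WeierstrassCurve.evalAt h : K̄[E] →ₐ[K̄] K̄`, evaluation at the affine point `(a, b)`;
  `maxIdealAt h`, its kernel `𝔪_P` as a `HeightOneSpectrum` of `K̄[E]`; **`exists_maxIdealAt_eq`**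
  (every maximal ideal of `K̄[E]` is some `𝔪_P`, from Mathlib's Nullstellensatz for `K̄[x, y]`).
* `WeierstrassCurve.place : E(K̄) → PlaceOver K̄ K̄(E)` (local ring at an affine point, place at
  infinity at `O`), **bijective** (`place_surjective`, `place_injective`); `HasValueAt.mem_place`
  (a function with a value at `P` is regular at `P`), `hasResidueField_place` (residue field `K̄`),
  `finite_setOf_not_mem_place` (finitely many poles).
* `WeierstrassCurve.Isogeny.pullbackHom φ : K̄(E') →ₐ[K̄] K̄(E)`, **the field embedding `φ^*`**
  (`x' ↦ φ^* x'`, `y' ↦ φ^* y'`; the tree's `funcAlgHom`), with `fieldRange_pullbackHom :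
  range φ^* = Isogeny.pullbackField φ`, `comap_pullbackHom_ne_top`, `hasValueAt_pullbackHom_algebraMap`
  (`(φ^* r)(P) = r(φ P)`), `comap_pullbackHom_place` (the place at `P` lies above the place at `φ P`).
* `Isogeny.card_ker_le_finSepDegree`, `Isogeny.finSepDegree_le_card_ker`,
  `Isogeny.card_ker_eq_finSepDegree_holds`.

## Faithfulness

`Isogeny.pullbackField φ = K̄(φ^* x', φ^* y')` is literally Silverman's `φ^* K̄(E₂)`
(`fieldRange_pullbackHom`), so `Field.finSepDegree (pullbackField φ) K̄(E)` is his `deg_s φ`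
(II.§2, p. 21: "the separable degree of the extension `K(C₁)/φ^* K(C₂)`"), and
`Nat.card (ker φ)` is `#ker φ = #φ⁻¹(O)` (III.4.9). Nothing is assumed beyond `[W.IsElliptic]`,
`[W'.IsElliptic]`, exactly as in the vendored statement.

## Mathlib

Used: `Field.finSepDegree`/`Field.Emb`, `Field.finSepDegree_eq` (`[L:F]_s = [S:F]`, `S` the
separable closure), `Field.exists_primitive_element`, `Polynomial.separable_def'`,
`Polynomial.card_rootSet_eq_natDegree`, `Polynomial.lifts`, `ValuationSubring.{comap, nonunits,
eq_of_le_of_ne_top}`, `Ideal.image_subset_nonunits_valuationSubring` (Chevalley),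
`MvPolynomial.eq_vanishingIdeal_singleton_of_isMaximal` (Nullstellensatz),
`IsDedekindDomain.HeightOneSpectrum.valuation`, `Valuation.Integers.isIntegral_iff_v_le_one`,
`minpoly.AlgHom.fintype`. Mathlib has no places-of-function-fields ↔ points dictionary, no `φ^*`
and no separable degree of a map of curves (searched `Mathlib/AlgebraicGeometry/EllipticCurve`:
`finSepDegree` does not occur; `HeightOneSpectrum` occurs only in `Reduction`/`LFunction`, for
primes of the base ring).

## References

* [SilvermanAEC2009] J. H. Silverman, *The Arithmetic of Elliptic Curves*, 2nd ed., GTM 106,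
  Springer 2009: II.§2 (Thm. II.2.4, `deg_s`, **Prop. II.2.6(b)**, p. 24), III.§4 (Cor. III.4.9,
  **Thm. III.4.10 and its proof, pp. 72–73**); read as `lit read
  book:silverman2009-arithmetic-elliptic-curves-2nd-ed --pages 30-34, 71-72`.
* R. Hartshorne, *Algebraic Geometry*, GTM 52, Springer 1977, Prop. II.6.8–II.6.9 (Silverman's
  source for II.2.6).
* J. Neukirch, *Algebraic Number Theory*, Springer 1999, Prop. I.8.3 (Dedekind–Kummer).
* C. Chevalley, *Introduction to the Theory of Algebraic Functions of One Variable*, AMS 1951,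
  I.§1 (extension of places).

## Design choices

* `noncomputable section`, `open scoped Classical`, `K : Type u`, dot-notation extensions in
  `namespace WeierstrassCurve`, everything over `K̄ = AlgebraicClosure K`, as in the sibling files;
  the general part in `namespace Literature.SeparableDegreePlaces`.
* Places are handled as Mathlib `ValuationSubring`s and restriction to subfields as
  `ValuationSubring.comap`; the residue-field hypothesis `HasResidueField` is membership-based
  (no quotient types), so that it transports along `F ≅ φ^* K̄(E')` and along `comap` for free.
* The lower bound is organised so that only places at *affine points of agreement* of `φ` with
  its rational representation are ever compared with places of `K̄(E')` (the finitely many other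
  points are avoided by the generic choice of `P₀`); no extension of `φ` to non-`K̄`-points and no
  surjectivity of `φ` is needed (`Q` is chosen as `φ P₀`).
-/

noncomputable section

open scoped Classical
open scoped Polynomial.Bivariate
open scoped IntermediateField
open Polynomial

universe u v w

/-! ## Places above a good place: the generic lower bound `≥ [L : F]_s` (general fields) -/

namespace Literature.NumberTheory.EllipticCurves.SeparableDegreePlaces


/-! ## Valuation subrings whose residue field is a subfield -/

section Residue

variable {F : Type u} [Field F] {k : Type w} [Field k]

/-- Non-units of a valuation subring times elements of the subring are non-units (the non-units
form the maximal ideal). [folklore] -/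
theorem mul_mem_nonunits (O : ValuationSubring F) {x y : F} (hx : x ∈ O.nonunits) (hy : y ∈ O) :
    x * y ∈ O.nonunits := by
  rw [ValuationSubring.mem_nonunits_iff] at hx ⊢
  rw [← O.valuation_le_one_iff] at hy
  rw [map_mul]
  exact mul_lt_one_of_lt_of_le hx hy

/-- A unit of a valuation subring (an element with inverse in the subring) is not a non-unit.
[folklore] -/
theorem not_mem_nonunits_of_inv_mem (O : ValuationSubring F) {x : F} (hx : x ≠ 0)
    (hinv : x⁻¹ ∈ O) : x ∉ O.nonunits := by
  rw [ValuationSubring.mem_nonunits_iff_or, not_or]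
  exact ⟨hx, not_not.mpr hinv⟩

/-- The non-units of the improper valuation subring `F ⊆ F` are `{0}`. [folklore] -/
theorem mem_nonunits_top_iff {x : F} : x ∈ (⊤ : ValuationSubring F).nonunits ↔ x = 0 := by
  rw [ValuationSubring.mem_nonunits_iff_or]
  simp [ValuationSubring.mem_top]

/-- A proper valuation subring has a non-zero non-unit. [folklore] -/
theorem exists_mem_nonunits_ne_zero (O : ValuationSubring F) (hO : O ≠ ⊤) :
    ∃ x ∈ O.nonunits, x ≠ 0 := by
  obtain ⟨z, hz⟩ : ∃ z : F, z ∉ O := by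
    by_contra! h
    exact hO (eq_top_iff.mpr fun z _ ↦ h z)
  have hz0 : z ≠ 0 := fun h ↦ hz (h ▸ O.zero_mem)
  refine ⟨z⁻¹, ?_, inv_ne_zero hz0⟩
  rw [ValuationSubring.inv_mem_nonunits_iff]
  exact Or.inr hz


/-- Non-units are preserved and reflected by restriction along an injective ring map. [folklore] -/
theorem mem_nonunits_comap_iff {L : Type v} [Field L] {f : F →+* L} (hf : Function.Injective f)
    (𝔓 : ValuationSubring L) (x : F) : x ∈ (𝔓.comap f).nonunits ↔ f x ∈ 𝔓.nonunits := by
  rw [ValuationSubring.mem_nonunits_iff_or, ValuationSubring.mem_nonunits_iff_or,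
    ValuationSubring.mem_comap, map_inv₀, map_eq_zero_iff f hf]

/-- **The residue field of the valuation subring `O` of `F` is the subfield `k`** (embedded by
`j : k →+* F`): `j(k) ⊆ O` and every element of `O` is congruent to an element of `j(k)` modulo
the maximal ideal (the non-units) of `O`. For the local ring `O = K̄[C]_P` of a point of a curve
over an algebraically closed field `K̄` this says that every function regular at `P` has a value
`f(P) ∈ K̄` (Silverman, *AEC*, I.§1–II.§1). [folklore] -/
structure HasResidueField (O : ValuationSubring F) (j : k →+* F) : Prop where
  /-- The constants lie in the valuation ring. -/
  mem : ∀ c : k, j c ∈ O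
  /-- Every element of the valuation ring is congruent to a constant modulo the maximal ideal. -/
  exists_sub_mem : ∀ z ∈ O, ∃ c : k, z - j c ∈ O.nonunits

namespace HasResidueField

variable {O : ValuationSubring F} {j : k →+* F} (h : HasResidueField O j)
include h

/-- A constant which is a non-unit of `O` is zero. [folklore] -/
theorem eq_zero_of_mem_nonunits {c : k} (hc : j c ∈ O.nonunits) : c = 0 := by
  by_contra hc0
  refine not_mem_nonunits_of_inv_mem O ((map_ne_zero j).mpr hc0) ?_ hc
  rw [← map_inv₀]
  exact h.mem _

/-- The constant congruent to a given element is unique. [folklore] -/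
theorem unique {z : F} {c c' : k} (hc : z - j c ∈ O.nonunits) (hc' : z - j c' ∈ O.nonunits) :
    c = c' := by
  have hsub : j (c' - c) ∈ O.nonunits := by
    have := O.nonunits.sub_mem hc hc'
    rwa [sub_sub_sub_cancel_left, ← map_sub] at this
  have := h.eq_zero_of_mem_nonunits hsub
  rwa [sub_eq_zero, eq_comm] at this

/-- The residue of `z ∈ O`: the unique constant `c` with `z ≡ j c` modulo the maximal ideal
(as a bare function; it is a ring homomorphism, `HasResidueField.res`). [folklore] -/
def resFun (z : O) : k :=
  Classical.choose (h.exists_sub_mem z z.2)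

/-- Defining property of `resFun`. [folklore] -/
theorem sub_resFun_mem (z : O) : (z : F) - j (h.resFun z) ∈ O.nonunits :=
  Classical.choose_spec (h.exists_sub_mem z z.2)

/-- Characterisation of `resFun z` as the unique constant congruent to `z`. [folklore] -/
theorem resFun_eq_iff (z : O) (c : k) : h.resFun z = c ↔ (z : F) - j c ∈ O.nonunits :=
  ⟨fun hc ↦ hc ▸ h.sub_resFun_mem z, fun hc ↦ h.unique (h.sub_resFun_mem z) hc⟩

/-- **The residue map `O →+* k`** of a valuation subring whose residue field is the subfield
`k` (Silverman, *AEC*, II.§1: `f ↦ f(P)` on `K̄[C]_P`). [folklore] -/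
def res : O →+* k where
  toFun := h.resFun
  map_one' := by
    rw [resFun_eq_iff, OneMemClass.coe_one, map_one, sub_self]
    exact O.nonunits.zero_mem
  map_mul' z w := by
    rw [resFun_eq_iff, map_mul, Subring.coe_mul]
    have e : (z : F) * w - j (h.resFun z) * j (h.resFun w) =
        ((z : F) - j (h.resFun z)) * w + ((w : F) - j (h.resFun w)) * j (h.resFun z) := by ring
    rw [e]
    exact O.nonunits.add_mem (mul_mem_nonunits O (h.sub_resFun_mem z) w.2)
      (mul_mem_nonunits O (h.sub_resFun_mem w) (h.mem _))
  map_zero' := by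
    rw [resFun_eq_iff, ZeroMemClass.coe_zero, map_zero, sub_self]
    exact O.nonunits.zero_mem
  map_add' z w := by
    rw [resFun_eq_iff, map_add, Subring.coe_add]
    have e : (z : F) + w - (j (h.resFun z) + j (h.resFun w)) =
        ((z : F) - j (h.resFun z)) + ((w : F) - j (h.resFun w)) := by ring
    rw [e]
    exact O.nonunits.add_mem (h.sub_resFun_mem z) (h.sub_resFun_mem w)

/-- Unfolding `res`. [folklore] -/
theorem res_apply (z : O) : h.res z = h.resFun z := rfl

/-- `z ≡ res z` modulo the maximal ideal. [folklore] -/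
theorem sub_res_mem (z : O) : (z : F) - j (h.res z) ∈ O.nonunits :=
  h.sub_resFun_mem z

/-- `res z = c ↔ z ≡ j c`. [folklore] -/
theorem res_eq_iff (z : O) (c : k) : h.res z = c ↔ (z : F) - j c ∈ O.nonunits :=
  h.resFun_eq_iff z c

/-- The residue of a constant is the constant. [folklore] -/
theorem res_const (c : k) : h.res ⟨j c, h.mem c⟩ = c := by
  rw [res_eq_iff, sub_self]
  exact O.nonunits.zero_mem

/-- The kernel of the residue map is the maximal ideal. [folklore] -/
theorem res_eq_zero_iff (z : O) : h.res z = 0 ↔ (z : F) ∈ O.nonunits := by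
  rw [res_eq_iff, map_zero, sub_zero]

/-- The residue map is surjective. [folklore] -/
theorem res_surjective : Function.Surjective h.res :=
  fun c ↦ ⟨⟨j c, h.mem c⟩, h.res_const c⟩

end HasResidueField

end Residue

/-! ## The generic lower bound for the number of places above a place -/

section Core

variable {F : Type u} {L : Type v} [Field F] [Field L] [Algebra F L]

/-- A polynomial all of whose coefficients lie in a subring lifts to the subring. [folklore] -/
theorem mem_lifts_of_coeffs_subset (O : ValuationSubring F) {p : F[X]}
    (hp : (↑p.coeffs : Set F) ⊆ O) : p ∈ Polynomial.lifts (algebraMap O F) := by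
  rw [lifts_iff_coeff_lifts]
  intro n
  by_cases hn : p.coeff n = 0
  · exact ⟨0, by rw [hn, map_zero]⟩
  · exact ⟨⟨p.coeff n, hp (coeff_mem_coeffs hn)⟩, rfl⟩

variable (F L) in
/-- **The separable degree as the degree of a minimal polynomial**: there is `α ∈ L`, separable
over `F`, whose minimal polynomial has degree `[L : F]_s` (a primitive element of the separable
closure of `F` in `L`). [folklore] -/
theorem exists_isSeparable_natDegree_minpoly_eq [FiniteDimensional F L] :
    ∃ α : L, IsSeparable F α ∧ (minpoly F α).natDegree = Field.finSepDegree F L := by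
  set S := separableClosure F L
  obtain ⟨α₀, hα₀⟩ := Field.exists_primitive_element F S
  refine ⟨(α₀ : L), mem_separableClosure_iff.mp α₀.2, ?_⟩
  have h1 : Field.finSepDegree F L = Module.finrank F S := Field.finSepDegree_eq F L
  have h2 : Module.finrank F S = Module.finrank F (⊤ : IntermediateField F S) :=
    (IntermediateField.finrank_top' (F := F) (E := S)).symm
  have h3 : Module.finrank F F⟮α₀⟯ = (minpoly F α₀).natDegree :=
    IntermediateField.adjoin.finrank (Algebra.IsIntegral.isIntegral α₀)
  rw [h1, h2, ← hα₀, h3, IntermediateField.minpoly_eq]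

/-- The key step (Dedekind–Kummer): with the notation of the module docstring, the ideal
`(𝔪_O, t - ρ) · A` of `A = O[α]` is proper when `ρ` is a root of the reduced minimal polynomial.
Stated for the ring map `ev : O[t] → L`, `t ↦ α`, with range `A`. [folklore] -/
theorem map_span_ne_top {k : Type w} [Field k] {O : ValuationSubring F} {j : k →+* F}
    (h : HasResidueField O j) {α : L} {m₀ : O[X]} (hm₀ : m₀.Monic)
    (hm : m₀.map (algebraMap O F) = minpoly F α) {ρ : k} (hρ : (m₀.map h.res).eval ρ = 0) :
    Ideal.map (eval₂RingHom ((algebraMap F L).comp (algebraMap O F)) α).rangeRestrict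
      (Ideal.span ((fun μ : O ↦ C μ) '' (IsLocalRing.maximalIdeal O : Set O) ∪
        {X - C ⟨j ρ, h.mem ρ⟩})) ≠ ⊤ := by
  set ev : O[X] →+* L := eval₂RingHom ((algebraMap F L).comp (algebraMap O F)) α with hev
  set J : Ideal O[X] := Ideal.span ((fun μ : O ↦ C μ) '' (IsLocalRing.maximalIdeal O : Set O) ∪
    {X - C ⟨j ρ, h.mem ρ⟩}) with hJ
  intro htop
  -- `1 = ev g` with `g ∈ J`
  have h1 : (1 : ev.range) ∈ J.map ev.rangeRestrict := htop ▸ Submodule.mem_top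
  obtain ⟨g, hg, hg1⟩ := (Ideal.mem_map_iff_of_surjective _ ev.rangeRestrict_surjective).mp h1
  have hg1' : ev g = 1 := by simpa using congrArg Subtype.val hg1
  -- `m₀ ∣ g - 1`
  have hdvd : m₀ ∣ g - 1 := by
    have hinj : Function.Injective (algebraMap O F) := Subtype.val_injective
    rw [← Polynomial.map_dvd_map (algebraMap O F) hinj hm₀, hm]
    apply minpoly.dvd
    rw [aeval_def, eval₂_map, ← coe_eval₂RingHom, ← hev, map_sub, hg1', map_one, sub_self]
  obtain ⟨q, hq⟩ := hdvd
  -- reduce and evaluate at `ρ`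
  set θ : O[X] →+* k := (evalRingHom ρ).comp (mapRingHom h.res) with hθ
  have hθJ : ∀ p ∈ J, θ p = 0 := by
    intro p hp
    rw [← RingHom.mem_ker]
    refine (Ideal.span_le (I := RingHom.ker θ)).mpr ?_ hp
    rintro p (⟨μ, hμ, rfl⟩ | hp)
    · rw [SetLike.mem_coe, RingHom.mem_ker, hθ, RingHom.comp_apply, coe_mapRingHom, map_C,
        coe_evalRingHom, eval_C, h.res_eq_zero_iff]
      exact ValuationSubring.coe_mem_nonunits_iff.mpr hμ
    · rw [Set.mem_singleton_iff] at hp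
      rw [hp, SetLike.mem_coe, RingHom.mem_ker, hθ, RingHom.comp_apply, coe_mapRingHom,
        Polynomial.map_sub, map_X, map_C, coe_evalRingHom, eval_sub, eval_X, eval_C, h.res_const,
        sub_self]
  have hθm : θ m₀ = 0 := by
    rw [hθ, RingHom.comp_apply, coe_mapRingHom, coe_evalRingHom, hρ]
  have key : θ (g - 1) = 0 := by rw [hq, map_mul, hθm, zero_mul]
  rw [map_sub, map_one, hθJ g hg, zero_sub, neg_eq_zero] at key
  exact one_ne_zero key

variable (F L) in
/-- **Generic lower bound for the number of places above a place.** For a finite extension of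
fields `L/F` there is a finite set `B ⊆ F` such that: for every valuation subring `O ≠ F` of `F`
containing `B`, whose residue field is an algebraically closed subfield `k ⊆ O`
(`HasResidueField O j`), there are `[L : F]_s` pairwise distinct valuation subrings `𝔓 ≠ L` of `L`
above `O` (`O ⊆ 𝔓 ∩ F`). For function fields of curves over `k = K̄` this is the inequality
`#φ⁻¹(Q) ≥ deg_s φ` of Silverman, *AEC*, Prop. II.2.6(b) at the cofinitely many points `Q` where
the elements of `B` are regular. [cite: SilvermanAEC2009, Prop. II.2.6(b)] -/
theorem exists_finset_card_le_places [FiniteDimensional F L] :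
    ∃ B : Finset F, ∀ (O : ValuationSubring F), O ≠ ⊤ → (↑B : Set F) ⊆ O →
      ∀ {k : Type w} [Field k] [IsAlgClosed k] (j : k →+* F), HasResidueField O j →
        ∃ 𝔓 : Fin (Field.finSepDegree F L) → ValuationSubring L,
          Function.Injective 𝔓 ∧ ∀ i, 𝔓 i ≠ ⊤ ∧ O ≤ (𝔓 i).comap (algebraMap F L) := by
  classical
  -- a separable element whose minimal polynomial has degree `[L : F]_s`, and Bezout
  obtain ⟨α, hαsep, hαdeg⟩ := exists_isSeparable_natDegree_minpoly_eq F L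
  set n := Field.finSepDegree F L with hn
  set m := minpoly F α with hm_def
  have hαint : IsIntegral F α := Algebra.IsIntegral.isIntegral α
  have hm_monic : m.Monic := minpoly.monic hαint
  obtain ⟨a, b, hab⟩ := (separable_def' m).mp hαsep
  refine ⟨m.coeffs ∪ a.coeffs ∪ b.coeffs, fun O hO hB k _ _ j hj ↦ ?_⟩
  simp only [Finset.coe_union, Set.union_subset_iff] at hB
  obtain ⟨⟨hBm, hBa⟩, hBb⟩ := hB
  -- lift `m, a, b` to `O[X]`
  obtain ⟨m₀, hm₀, -, hm₀monic⟩ :=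
    lifts_and_natDegree_eq_and_monic (mem_lifts_of_coeffs_subset O hBm) hm_monic
  obtain ⟨a₀, ha₀⟩ := (mem_lifts _).mp (mem_lifts_of_coeffs_subset O hBa)
  obtain ⟨b₀, hb₀⟩ := (mem_lifts _).mp (mem_lifts_of_coeffs_subset O hBb)
  have hsep₀ : m₀.Separable := by
    rw [separable_def']
    refine ⟨a₀, b₀, Polynomial.map_injective (algebraMap O F) Subtype.val_injective ?_⟩
    rw [Polynomial.map_add, Polynomial.map_mul, Polynomial.map_mul, ← Polynomial.derivative_map,
      ha₀, hb₀, hm₀, Polynomial.map_one, hab]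
  -- the reduced polynomial and its `n` distinct roots in `k`
  set mk : k[X] := m₀.map hj.res with hmk
  have hmk_monic : mk.Monic := hm₀monic.map _
  have hmk_sep : mk.Separable := hsep₀.map
  have hmk_deg : mk.natDegree = n := by
    rw [hmk, hm₀monic.natDegree_map, ← hαdeg, ← hm₀, hm₀monic.natDegree_map]
  have hcard : Fintype.card (mk.rootSet k) = n := by
    rw [← hmk_deg]
    refine card_rootSet_eq_natDegree hmk_sep ?_
    rw [Algebra.algebraMap_self, Polynomial.map_id]
    exact IsAlgClosed.splits mk
  set ρ : Fin n → k := fun i ↦ ((Fintype.equivFinOfCardEq hcard).symm i : k) with hρ_def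
  have hρ_inj : Function.Injective ρ := fun i i' hii' ↦
    (Fintype.equivFinOfCardEq hcard).symm.injective (Subtype.ext hii')
  have hρ_root : ∀ i, mk.eval (ρ i) = 0 := fun i ↦ by
    have := ((Fintype.equivFinOfCardEq hcard).symm i).2
    rw [mem_rootSet] at this
    simpa using this.2
  -- the ring `A = O[α] ⊆ L` and Chevalley's theorem for the ideals `(𝔪_O, α - ρ i)`
  set f : O →+* L := (algebraMap F L).comp (algebraMap O F) with hf
  set ev : O[X] →+* L := eval₂RingHom f α with hev
  have hJ := fun i ↦ map_span_ne_top (L := L) hj hm₀monic hm₀ (hρ_root i)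
  choose 𝔓 h𝔓A h𝔓I using fun i ↦ Ideal.image_subset_nonunits_valuationSubring _ (hJ i)
  -- what Chevalley's theorem gives, concretely
  have hmemA : ∀ p : O[X], ∀ i, ev p ∈ 𝔓 i := fun p i ↦ h𝔓A i ⟨p, rfl⟩
  have hle : ∀ i, O ≤ (𝔓 i).comap (algebraMap F L) := fun i z hz ↦ by
    rw [ValuationSubring.mem_comap]
    have := hmemA (C ⟨z, hz⟩) i
    rwa [hev, coe_eval₂RingHom, eval₂_C] at this
  have hnonunit : ∀ i, ∀ p ∈ Ideal.span ((fun μ : O ↦ C μ) '' (IsLocalRing.maximalIdeal O : Set O) ∪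
      {X - C ⟨j (ρ i), hj.mem (ρ i)⟩}), ev p ∈ (𝔓 i).nonunits := fun i p hp ↦
    h𝔓I i ⟨ev.rangeRestrict p, Ideal.mem_map_of_mem _ hp, rfl⟩
  have hmax : ∀ i, ∀ μ : O, μ ∈ IsLocalRing.maximalIdeal O → f μ ∈ (𝔓 i).nonunits := by
    intro i μ hμ
    have := hnonunit i (C μ) (Ideal.subset_span (Or.inl ⟨μ, hμ, rfl⟩))
    rwa [hev, coe_eval₂RingHom, eval₂_C] at this
  have hroot : ∀ i, α - algebraMap F L (j (ρ i)) ∈ (𝔓 i).nonunits := by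
    intro i
    have := hnonunit i (X - C ⟨j (ρ i), hj.mem (ρ i)⟩) (Ideal.subset_span (Or.inr rfl))
    rwa [hev, coe_eval₂RingHom, eval₂_sub, eval₂_X, eval₂_C] at this
  refine ⟨𝔓, fun i i' hii' ↦ ?_, fun i ↦ ⟨fun htop ↦ ?_, hle i⟩⟩
  · -- distinct: `ρ i' - ρ i` would be a non-unit
    apply hρ_inj
    by_contra hne
    have hsub : algebraMap F L (j (ρ i' - ρ i)) ∈ (𝔓 i).nonunits := by
      have := (𝔓 i).nonunits.sub_mem (hroot i) (hii' ▸ hroot i')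
      rwa [sub_sub_sub_cancel_left, ← map_sub, ← map_sub] at this
    have hc0 : ρ i' - ρ i ≠ 0 := sub_ne_zero.mpr (Ne.symm hne)
    refine not_mem_nonunits_of_inv_mem (𝔓 i) ?_ ?_ hsub
    · exact (_root_.map_ne_zero _).mpr ((_root_.map_ne_zero j).mpr hc0)
    · rw [← map_inv₀, ← map_inv₀]
      exact hle i (hj.mem _)
  · -- proper: a non-zero element of `𝔪_O` is a non-unit of `𝔓 i`
    obtain ⟨x, hx, hx0⟩ := exists_mem_nonunits_ne_zero O hO
    have hxO : x ∈ O := O.nonunits_subset hx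
    have h1 : f ⟨x, hxO⟩ ∈ (𝔓 i).nonunits :=
      hmax i ⟨x, hxO⟩ (ValuationSubring.coe_mem_nonunits_iff.mp hx)
    rw [htop, mem_nonunits_top_iff, hf, RingHom.comp_apply, map_eq_zero] at h1
    exact hx0 h1

end Core

end Literature.NumberTheory.EllipticCurves.SeparableDegreePlaces

namespace WeierstrassCurve

open geomPoints Literature.NumberTheory.EllipticCurves.WeierstrassFunctionField Literature.NumberTheory.DiophantineGeometry.AlgFunctionField IsDedekindDomain
open Literature.NumberTheory.EllipticCurves.SeparableDegreePlaces

variable {K : Type u} [Field K] {W W' : WeierstrassCurve K}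

/-! ## Evaluation at affine points; the maximal ideals of `K̄[E]` are the affine points -/

section Points

variable (W) in
/-- The affine coordinate ring `K̄[E]` of `E = W` over `K̄`. [folklore] -/
abbrev geomCoordRing : Type u :=
  (W.baseChange (AlgebraicClosure K)).toAffine.CoordinateRing

/-- **Evaluation of regular functions at the affine point `(a, b) ∈ E(K̄)`**, the `K̄`-algebra map
`K̄[E] → K̄`, `x ↦ a`, `y ↦ b`. Silverman, *AEC*, I.§1 (`f(P)`), II.§1. [folklore] -/
def evalAt {a b : AlgebraicClosure K}
    (h : (W.baseChange (AlgebraicClosure K)).toAffine.Nonsingular a b) :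
    W.geomCoordRing →ₐ[AlgebraicClosure K] AlgebraicClosure K :=
  pointAlgHom (W.baseChange (AlgebraicClosure K)).toAffine a b (by
    rw [Algebra.algebraMap_self, Polynomial.mapRingHom_id, Polynomial.map_id]
    exact h.1)

variable {a b : AlgebraicClosure K} (h : (W.baseChange (AlgebraicClosure K)).toAffine.Nonsingular a b)

/-- Evaluation of (the class of) `p ∈ K̄[X][Y]` at `(a, b)` is `p(a, b)`. [folklore] -/
theorem evalAt_mk (p : (AlgebraicClosure K)[X][Y]) :
    evalAt h (Affine.CoordinateRing.mk _ p) = p.evalEval a b := by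
  rw [evalAt, pointAlgHom_mk, Algebra.algebraMap_self, Polynomial.mapRingHom_id, Polynomial.map_id]

/-- Evaluation of a two-variable polynomial (through Mathlib's `K̄[X][Y] ≃ K̄[x₀, x₁]`) at `(a, b)`.
[folklore] -/
theorem evalAt_mk_equivMvPolynomial_symm (g : MvPolynomial (Fin 2) (AlgebraicClosure K)) :
    evalAt h (Affine.CoordinateRing.mk _
      ((Polynomial.Bivariate.equivMvPolynomial (AlgebraicClosure K)).symm g)) =
      MvPolynomial.eval ![a, b] g := by
  rw [evalAt_mk, eval_eq_evalEval_equivMvPolynomial_symm]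

/-- Evaluation of `p(x) ∈ K̄[x]` at `(a, b)` is `p(a)`. [folklore] -/
theorem evalAt_algebraMap (p : (AlgebraicClosure K)[X]) :
    evalAt h (algebraMap _ W.geomCoordRing p) = p.eval a := by
  rw [evalAt, pointAlgHom_algebraMap, aeval_def, eval₂_eq_eval_map, Algebra.algebraMap_self,
    Polynomial.map_id]

/-- Evaluation at a point is surjective onto `K̄`. [folklore] -/
theorem evalAt_surjective : Function.Surjective (evalAt h) :=
  fun c ↦ ⟨algebraMap (AlgebraicClosure K) W.geomCoordRing c, AlgHom.commutes _ c⟩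

/-- **The maximal ideal `𝔪_P ⊂ K̄[E]` of the affine point `P = (a, b)`** (the kernel of evaluation
at `P`), as a point of the height-one spectrum of the Dedekind domain `K̄[E]`. Silverman, *AEC*,
I.§1 (`M_P`), Prop. II.1.1. [folklore] -/
def maxIdealAt [W.IsElliptic] : HeightOneSpectrum W.geomCoordRing where
  asIdeal := RingHom.ker (evalAt h)
  isPrime := RingHom.ker_isPrime _
  ne_bot := by
    haveI : (RingHom.ker (evalAt h)).IsMaximal :=
      RingHom.ker_isMaximal_of_surjective _ (evalAt_surjective h)
    exact Literature.NumberTheory.EllipticCurves.WeierstrassCoordinateRing.ne_bot_of_isMaximal _ (RingHom.ker (evalAt h))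

/-- Membership in `𝔪_P`: `r ∈ 𝔪_P ↔ r(P) = 0`. [folklore] -/
theorem mem_maxIdealAt_iff [W.IsElliptic] (r : W.geomCoordRing) :
    r ∈ (maxIdealAt h).asIdeal ↔ evalAt h r = 0 :=
  RingHom.mem_ker

/-- **Nullstellensatz for `K̄[E]`: every maximal ideal of `K̄[E]` is the ideal `𝔪_P` of an affine
point `P ∈ E(K̄)`** (pull back to `K̄[X, Y]` and apply Mathlib's Nullstellensatz
`MvPolynomial.eq_vanishingIdeal_singleton_of_isMaximal`; the zero `(a, b)` lies on `E` because
the Weierstrass polynomial lies in the ideal). Silverman, *AEC*, I.§1 (points `↔` maximal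
ideals, over `K̄`). [folklore] -/
theorem exists_maxIdealAt_eq [W.IsElliptic] (v : HeightOneSpectrum W.geomCoordRing) :
    ∃ (a b : AlgebraicClosure K) (h : (W.baseChange (AlgebraicClosure K)).toAffine.Nonsingular a b),
      maxIdealAt h = v := by
  haveI := v.isMaximal
  let e := Polynomial.Bivariate.equivMvPolynomial (AlgebraicClosure K)
  let mk := Affine.CoordinateRing.mk (W.baseChange (AlgebraicClosure K)).toAffine
  have hmk : Function.Surjective mk := AdjoinRoot.mk_surjective
  let M' : Ideal (MvPolynomial (Fin 2) (AlgebraicClosure K)) :=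
    v.asIdeal.comap (mk.comp (e.symm : MvPolynomial (Fin 2) (AlgebraicClosure K) →+*
      (AlgebraicClosure K)[X][Y]))
  have hM'max : M'.IsMaximal :=
    Ideal.comap_isMaximal_of_surjective (mk.comp (e.symm : MvPolynomial (Fin 2) (AlgebraicClosure K)
      →+* (AlgebraicClosure K)[X][Y])) (by exact hmk.comp e.symm.surjective)
  obtain ⟨v₀, hv₀⟩ :=
    MvPolynomial.eq_vanishingIdeal_singleton_of_isMaximal (K := AlgebraicClosure K) hM'max
  have key : ∀ g : MvPolynomial (Fin 2) (AlgebraicClosure K),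
      mk (e.symm g) ∈ v.asIdeal ↔ MvPolynomial.eval v₀ g = 0 := by
    intro g
    rw [show (mk (e.symm g) ∈ v.asIdeal) = (g ∈ M') from rfl, hv₀,
      MvPolynomial.mem_vanishingIdeal_singleton_iff]
    rfl
  have hv₀' : ![v₀ 0, v₀ 1] = v₀ := by
    ext i; fin_cases i <;> rfl
  have key' : ∀ p : (AlgebraicClosure K)[X][Y], mk p ∈ v.asIdeal ↔ p.evalEval (v₀ 0) (v₀ 1) = 0 := by
    intro p
    have h1 := key (e p)
    rw [AlgEquiv.symm_apply_apply, ← hv₀', eval_eq_evalEval_equivMvPolynomial_symm,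
      AlgEquiv.symm_apply_apply] at h1
    exact h1
  have heq : (W.baseChange (AlgebraicClosure K)).toAffine.Equation (v₀ 0) (v₀ 1) := by
    rw [Affine.Equation, ← key']
    change AdjoinRoot.mk _ (W.baseChange (AlgebraicClosure K)).toAffine.polynomial ∈ v.asIdeal
    rw [AdjoinRoot.mk_self]
    exact zero_mem _
  refine ⟨v₀ 0, v₀ 1, (Affine.equation_iff_nonsingular
    (W := (W.baseChange (AlgebraicClosure K)).toAffine)).mp heq, HeightOneSpectrum.ext ?_⟩
  ext r
  obtain ⟨p, rfl⟩ := hmk r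
  rw [mem_maxIdealAt_iff, key']
  exact (evalAt_mk _ p).symm ▸ Iff.rfl

end Points

/-! ## The places of `K̄(E)` are the points of `E(K̄)` -/

section Places

variable [W.IsElliptic]

variable (W) in
/-- **The place of `K̄(E)/K̄` at the point `P ∈ E(K̄)`**: the local ring `K̄[E]_P = K̄[E]_{𝔪_P}` of
an affine point (the finite place of the maximal ideal `𝔪_P`, `PlaceOver.ofPrime`), and the place
at infinity `O_∞` (the tree's `WeierstrassPlaceAtInfinity.infPlace`) at `P = O`. Silverman, *AEC*,
Prop. II.1.1 (`K̄[C]_P` is a discrete valuation ring), II.§2. [folklore] -/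
def place : W.geomPoints → PlaceOver (AlgebraicClosure K) W.geomFunctionField :=
  fun P ↦ match (P : (W.baseChange (AlgebraicClosure K)).toAffine.Point) with
    | .zero => Literature.NumberTheory.DiophantineGeometry.WeierstrassPlaceAtInfinity.infPlace (W.baseChange (AlgebraicClosure K)).toAffine
    | .some _ _ h => PlaceOver.ofPrime (AlgebraicClosure K) W.geomFunctionField (maxIdealAt h)

/-- The place at `O` is the place at infinity. [folklore] -/
@[simp] theorem place_zero : W.place 0 =
    Literature.NumberTheory.DiophantineGeometry.WeierstrassPlaceAtInfinity.infPlace (W.baseChange (AlgebraicClosure K)).toAffine :=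
  rfl

/-- The place at an affine point is the finite place of its maximal ideal. [folklore] -/
@[simp] theorem place_some {a b : AlgebraicClosure K}
    (h : (W.baseChange (AlgebraicClosure K)).toAffine.Nonsingular a b) :
    W.place (.some a b h) =
      PlaceOver.ofPrime (AlgebraicClosure K) W.geomFunctionField (maxIdealAt h) :=
  rfl

/-- **Every place of `K̄(E)/K̄` is the place of a point of `E(K̄)`** (classification of the places
of `K̄(E)`, `Literature.NumberTheory.DiophantineGeometry.WeierstrassPlaces.eq_infPlace_or_exists_eq_ofPrime`, and the Nullstellensatz
`exists_maxIdealAt_eq`). Silverman, *AEC*, Prop. II.1.1, II.§2 and Prop. III.3.1 (the points of a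
smooth projective curve are the discrete valuations of its function field). [folklore] -/
theorem place_surjective : Function.Surjective W.place := by
  intro 𝔔
  rcases Literature.NumberTheory.DiophantineGeometry.WeierstrassPlaces.eq_infPlace_or_exists_eq_ofPrime
    (W.baseChange (AlgebraicClosure K)).toAffine 𝔔 with h | ⟨v, hv⟩
  · exact ⟨0, h ▸ rfl⟩
  · obtain ⟨a, b, h, rfl⟩ := exists_maxIdealAt_eq v
    exact ⟨.some a b h, hv ▸ rfl⟩

/-- Distinct points have distinct places. [folklore] -/
theorem place_injective : Function.Injective W.place := by
  intro P Q hPQ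
  cases P with
  | zero =>
    cases Q with
    | zero => rfl
    | some a b h =>
      exact (Literature.NumberTheory.DiophantineGeometry.WeierstrassPlaces.infPlace_ne_ofPrime _ (maxIdealAt h)
        ((place_zero (W := W)).symm.trans (hPQ.trans (place_some h)))).elim
  | some a₁ b₁ h₁ =>
    cases Q with
    | zero =>
      exact (Literature.NumberTheory.DiophantineGeometry.WeierstrassPlaces.infPlace_ne_ofPrime _ (maxIdealAt h₁)
        ((place_zero (W := W)).symm.trans (hPQ.symm.trans (place_some h₁)))).elim
    | some a₂ b₂ h₂ =>
      have h12 : maxIdealAt h₁ = maxIdealAt h₂ :=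
        PlaceOver.ofPrime_injective ((place_some h₁).symm.trans (hPQ.trans (place_some h₂)))
      have hmem : ∀ r : W.geomCoordRing, evalAt h₁ r = 0 → evalAt h₂ r = 0 := fun r hr ↦ by
        rw [← mem_maxIdealAt_iff] at hr ⊢
        rwa [← h12]
      have ha : a₁ = a₂ := by
        have := hmem (algebraMap _ W.geomCoordRing (X - C a₁))
          (by rw [evalAt_algebraMap]; simp)
        rw [evalAt_algebraMap] at this
        simpa [sub_eq_zero, eq_comm] using this
      have hb : b₁ = b₂ := by
        have := hmem (Affine.CoordinateRing.mk _ (Polynomial.X - C (C b₁)))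
          (by rw [evalAt_mk]; simp)
        rw [evalAt_mk] at this
        simpa [sub_eq_zero, eq_comm] using this
      subst ha hb
      rfl

/-- **A function with a value at the affine point `P` is regular at `P`**: it lies in the local
ring `K̄[E]_P`, and minus its value it lies in the maximal ideal. Silverman, *AEC*, I.§1, II.§1
(`K̄[C]_P`, `M_P`). [folklore] -/
theorem HasValueAt.mem_place {z : W.geomFunctionField} {P : W.geomPoints} {c : AlgebraicClosure K}
    (hP : P ≠ 0) (hz : W.HasValueAt z P c) :
    z ∈ (W.place P).toValuationSubring ∧
      z - algebraMap (AlgebraicClosure K) W.geomFunctionField c ∈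
        (W.place P).toValuationSubring.nonunits := by
  obtain ⟨a, b, h, rfl⟩ := geomPoints.exists_eq_some hP
  obtain ⟨g, g', hg', hzg, hval⟩ := hz
  rw [xy_some] at hg' hval
  rw [place_some]
  set R := W.geomCoordRing
  set v := maxIdealAt h
  set e := Polynomial.Bivariate.equivMvPolynomial (AlgebraicClosure K)
  set G : R := Affine.CoordinateRing.mk _ (e.symm g) with hG
  set H : R := Affine.CoordinateRing.mk _ (e.symm g') with hH
  have hGe : W.evalGeneric g = algebraMap R W.geomFunctionField G := rfl
  have hHe : W.evalGeneric g' = algebraMap R W.geomFunctionField H := rfl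
  have hHv : v.valuation W.geomFunctionField (algebraMap R W.geomFunctionField H) = 1 := by
    refine le_antisymm (v.valuation_le_one H) (not_lt.mp fun hlt ↦ hg' ?_)
    rw [v.valuation_lt_one_iff_mem, mem_maxIdealAt_iff, hH, evalAt_mk_equivMvPolynomial_symm] at hlt
    exact hlt
  have hH0 : algebraMap R W.geomFunctionField H ≠ 0 := fun h0 ↦ by
    rw [h0, map_zero] at hHv; exact zero_ne_one hHv
  have hz' : z = algebraMap R W.geomFunctionField G / algebraMap R W.geomFunctionField H := by
    rw [eq_div_iff hH0, ← hHe, hzg, hGe]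
  constructor
  · rw [PlaceOver.mem_ofPrime_iff, hz', map_div₀, hHv, div_one]
    exact v.valuation_le_one G
  · -- `z - c = (G - c H)/H` with `(G - c H)(P) = 0`
    have hnum : G - algebraMap (AlgebraicClosure K) R c * H ∈ v.asIdeal := by
      rw [mem_maxIdealAt_iff, map_sub, map_mul, AlgHom.commutes, Algebra.algebraMap_self,
        RingHom.id_apply, hG, hH, evalAt_mk_equivMvPolynomial_symm, evalAt_mk_equivMvPolynomial_symm,
        hval, sub_self]
    have hlt : v.valuation W.geomFunctionField
        (z - algebraMap (AlgebraicClosure K) W.geomFunctionField c) < 1 := by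
      have : z - algebraMap (AlgebraicClosure K) W.geomFunctionField c =
          algebraMap R W.geomFunctionField (G - algebraMap (AlgebraicClosure K) R c * H) /
            algebraMap R W.geomFunctionField H := by
        rw [eq_div_iff hH0, sub_mul, hz', div_mul_cancel₀ _ hH0, map_sub, map_mul,
          ← IsScalarTower.algebraMap_apply]
      rw [this, map_div₀, hHv, div_one]
      exact (v.valuation_lt_one_iff_mem _).mpr hnum
    rw [ValuationSubring.mem_nonunits_iff]
    exact (Valuation.isEquiv_valuation_valuationSubring _).lt_one_iff_lt_one.mp hlt

/-- **The residue field of `K̄[E]_P` is `K̄`**: every function regular at the affine point `P` is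
congruent to a constant modulo `𝔪_P` (namely to its value). Silverman, *AEC*, I.§1–II.§1.
[folklore] -/
theorem hasResidueField_place {P : W.geomPoints} (hP : P ≠ 0) :
    HasResidueField (W.place P).toValuationSubring
      (algebraMap (AlgebraicClosure K) W.geomFunctionField) := by
  obtain ⟨a, b, h, rfl⟩ := geomPoints.exists_eq_some hP
  refine ⟨(W.place _).algebraMap_mem, fun z hz ↦ ?_⟩
  rw [place_some] at hz ⊢
  set R := W.geomCoordRing
  set v := maxIdealAt h
  rw [PlaceOver.mem_ofPrime_iff] at hz
  obtain ⟨r, hr⟩ := Literature.NumberTheory.DiophantineGeometry.WeierstrassGenus.exists_valuation_sub_algebraMap_lt_one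
    (W.baseChange (AlgebraicClosure K)).toAffine v hz
  refine ⟨evalAt h r, ?_⟩
  have hr' : v.valuation W.geomFunctionField (algebraMap R W.geomFunctionField r -
      algebraMap (AlgebraicClosure K) W.geomFunctionField (evalAt h r)) < 1 := by
    rw [IsScalarTower.algebraMap_apply (AlgebraicClosure K) R W.geomFunctionField, ← map_sub,
      v.valuation_lt_one_iff_mem, mem_maxIdealAt_iff, map_sub, AlgHom.commutes, Algebra.algebraMap_self,
      RingHom.id_apply, sub_self]
  have hlt : v.valuation W.geomFunctionField
      (z - algebraMap (AlgebraicClosure K) W.geomFunctionField (evalAt h r)) < 1 := by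
    have : z - algebraMap (AlgebraicClosure K) W.geomFunctionField (evalAt h r) =
        (z - algebraMap R W.geomFunctionField r) + (algebraMap R W.geomFunctionField r -
          algebraMap (AlgebraicClosure K) W.geomFunctionField (evalAt h r)) := by ring
    rw [this]
    exact Valuation.map_add_lt _ hr hr'
  rw [ValuationSubring.mem_nonunits_iff]
  exact (Valuation.isEquiv_valuation_valuationSubring _).lt_one_iff_lt_one.mp hlt

/-- **A rational function is regular at all but finitely many points** (in the sense of places).
Silverman, *AEC*, II.§1 (finitely many poles). [folklore] -/
theorem finite_setOf_not_mem_place (z : W.geomFunctionField) :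
    {P : W.geomPoints | P ≠ 0 ∧ z ∉ (W.place P).toValuationSubring}.Finite := by
  obtain ⟨g, h, hh, rfl⟩ := exists_eq_evalGeneric_div z
  refine (finite_setOf_eval_xy_eq_zero hh).subset ?_
  rintro P ⟨hP0, hP⟩
  refine ⟨hP0, by_contra fun hne ↦ hP ?_⟩
  exact ((hasValueAt_div hP0 hne (g := g)).mem_place hP0).1

end Places

/-! ## The pull-back `φ^* : K̄(E') → K̄(E)` as a field embedding -/

namespace Isogeny

variable [W.IsElliptic] (φ : Isogeny W W')

/-- `(φ^* x', φ^* y')` is a solution of the Weierstrass equation of `E'` in `K̄(E)` (restating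
`Isogeny.equation_pullback` with the polynomial of `E'/K̄` mapped to `K̄(E)`). [folklore] -/
theorem evalEval_map_polynomial_pullback :
    ((W'.baseChange (AlgebraicClosure K)).toAffine.polynomial.map
      (mapRingHom (algebraMap (AlgebraicClosure K) W.geomFunctionField))).evalEval
        φ.pullbackX φ.pullbackY = 0 := by
  have h := Affine.baseChange_polynomial (W := W')
    (f := Algebra.ofId (AlgebraicClosure K) W.geomFunctionField)
  have he := φ.equation_pullback
  rw [Affine.Equation, h] at he
  exact he

/-- **The pull-back `φ^* : K̄(E') → K̄(E)`, `f ↦ f ∘ φ`**, as a `K̄`-algebra homomorphism: the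
map `x' ↦ φ^* x'`, `y' ↦ φ^* y'` out of `K̄(E') = Frac(K̄[x', y']/(W'))` (the tree's `funcAlgHom`
of the point `(φ^* x', φ^* y') ∈ E'(K̄(E))`, whose `x`-coordinate is transcendental). Silverman,
*AEC*, II.§2 (p. 20: `φ^* : K(C₂) → K(C₁)`), III.§4. [folklore] -/
def pullbackHom : W'.geomFunctionField →ₐ[AlgebraicClosure K] W.geomFunctionField :=
  funcAlgHom (V := (W'.baseChange (AlgebraicClosure K)).toAffine) φ.pullbackX φ.pullbackY
    φ.evalEval_map_polynomial_pullback φ.transcendental_pullbackX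

/-- `φ^*` sends `x'` to `φ^* x'`. [folklore] -/
@[simp] theorem pullbackHom_genX : φ.pullbackHom W'.genX = φ.pullbackX :=
  funcAlgHom_xF _ _ _ _

/-- `φ^*` sends `y'` to `φ^* y'`. [folklore] -/
@[simp] theorem pullbackHom_genY : φ.pullbackHom W'.genY = φ.pullbackY :=
  funcAlgHom_yF _ _ _ _

/-- `φ^*` on regular functions is the point map of `(φ^* x', φ^* y')`. [folklore] -/
theorem pullbackHom_algebraMap (r : W'.geomCoordRing) :
    φ.pullbackHom (algebraMap W'.geomCoordRing W'.geomFunctionField r) =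
      pointAlgHom _ φ.pullbackX φ.pullbackY φ.evalEval_map_polynomial_pullback r :=
  funcAlgHom_algebraMap _ _ _ _ r

/-- **The image of `φ^*` is `φ^* K̄(E') = K̄(φ^* x', φ^* y')`**, the subfield `Isogeny.pullbackField`
of `IsogenyDegree` (`K̄(E') = K̄(x', y')`). Silverman, *AEC*, III.§4 (p. 66). [folklore] -/
theorem fieldRange_pullbackHom : φ.pullbackHom.fieldRange = φ.pullbackField := by
  have htop := Literature.NumberTheory.EllipticCurves.WeierstrassFunctionField.adjoin_X_Y_eq_top
    (W'.baseChange (AlgebraicClosure K)).toAffine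
  rw [AlgHom.fieldRange_eq_map, ← htop, IntermediateField.adjoin_map, Isogeny.pullbackField]
  congr 1
  change φ.pullbackHom '' {W'.genX, W'.genY} = _
  rw [Set.image_pair, pullbackHom_genX, pullbackHom_genY]

/-- Membership in `φ^* K̄(E')`. [folklore] -/
theorem mem_pullbackField_iff (z : W.geomFunctionField) :
    z ∈ φ.pullbackField ↔ ∃ z' : W'.geomFunctionField, φ.pullbackHom z' = z := by
  rw [← fieldRange_pullbackHom, AlgHom.mem_fieldRange]

/-- `φ^* z' ∈ φ^* K̄(E')`. [folklore] -/
theorem pullbackHom_mem (z' : W'.geomFunctionField) : φ.pullbackHom z' ∈ φ.pullbackField :=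
  (φ.mem_pullbackField_iff _).mpr ⟨z', rfl⟩

variable [W'.IsElliptic]

/-- **A proper valuation ring of `K̄(E)` does not contain `φ^* K̄(E')`** (`K̄(E)` is algebraic over
`φ^* K̄(E')` by *AEC* II.2.4(a), and valuation rings are integrally closed). [folklore] -/
theorem exists_mem_pullbackField_not_mem {𝔓 : ValuationSubring W.geomFunctionField} (h𝔓 : 𝔓 ≠ ⊤) :
    ∃ z ∈ φ.pullbackField, z ∉ 𝔓 := by
  by_contra! hF
  haveI : FiniteDimensional φ.pullbackField W.geomFunctionField :=
    finiteDimensional_pullbackField_holds W W' φ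
  apply h𝔓
  rw [eq_top_iff]
  intro z _
  -- `z` is integral over `φ^* K̄(E') ⊆ 𝔓`, hence over `𝔓`, hence in `𝔓`
  letI : Algebra φ.pullbackField 𝔓 :=
    (RingHom.codRestrict (algebraMap φ.pullbackField W.geomFunctionField) 𝔓.toSubring
      (fun w ↦ hF w w.2)).toAlgebra
  haveI : IsScalarTower φ.pullbackField 𝔓 W.geomFunctionField :=
    IsScalarTower.of_algebraMap_eq (fun _ ↦ rfl)
  have hint : _root_.IsIntegral 𝔓 z :=
    (Algebra.IsIntegral.isIntegral (R := φ.pullbackField) z).tower_top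
  have hInt : 𝔓.valuation.Integers 𝔓 :=
    ⟨Subtype.val_injective, 𝔓.valuation_le_one,
      fun r hr ↦ ⟨⟨r, (𝔓.valuation_le_one_iff r).1 hr⟩, rfl⟩⟩
  exact (𝔓.valuation_le_one_iff z).1 (hInt.isIntegral_iff_v_le_one.1 hint)

/-- The restriction of a proper valuation ring of `K̄(E)` to `K̄(E')` along `φ^*` is proper.
[folklore] -/
theorem comap_pullbackHom_ne_top {𝔓 : ValuationSubring W.geomFunctionField} (h𝔓 : 𝔓 ≠ ⊤) :
    𝔓.comap (φ.pullbackHom : W'.geomFunctionField →+* W.geomFunctionField) ≠ ⊤ := by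
  obtain ⟨z, hz, hz𝔓⟩ := φ.exists_mem_pullbackField_not_mem h𝔓
  obtain ⟨z', rfl⟩ := (φ.mem_pullbackField_iff z).mp hz
  intro htop
  have : z' ∈ 𝔓.comap (φ.pullbackHom : W'.geomFunctionField →+* W.geomFunctionField) :=
    htop ▸ ValuationSubring.mem_top z'
  exact hz𝔓 (ValuationSubring.mem_comap.mp this)

omit [W'.IsElliptic] in
/-- **Values of pulled-back regular functions**: at a point `P` where `φ` agrees with its rational
representation (so that `φ P = (x'(φ P), y'(φ P))` is affine), `φ^* r` has the value `r(φ P)` for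
every `r ∈ K̄[E']`. Silverman, *AEC*, II.§2 (`(φ^* f)(P) = f(φ P)`). [folklore] -/
theorem hasValueAt_pullbackHom_algebraMap {P : W.geomPoints}
    (hP : AgreesWithRationalMapAt W W' φ.rationalRep.P₁ φ.rationalRep.Q₁ φ.rationalRep.P₂
      φ.rationalRep.Q₂ φ P)
    {a b : AlgebraicClosure K} (h : (W'.baseChange (AlgebraicClosure K)).toAffine.Nonsingular a b)
    (hφP : φ P = .some a b h) (r : W'.geomCoordRing) :
    W.HasValueAt (φ.pullbackHom (algebraMap W'.geomCoordRing W'.geomFunctionField r)) P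
      (evalAt h r) := by
  obtain ⟨hP0, hQ₁, hQ₂, h', e⟩ := agreesWithRationalMapAt_iff.mp hP
  rw [hφP] at e
  obtain ⟨ha, hb⟩ := Affine.Point.some.inj e
  -- values of `φ^* x'`, `φ^* y'` at `P`
  have hvx : W.HasValueAt φ.pullbackX P a := ha ▸ hasValueAt_div hP0 hQ₁
  have hvy : W.HasValueAt φ.pullbackY P b := hb ▸ hasValueAt_div hP0 hQ₂
  have hw : ∀ i, W.HasValueAt (![φ.pullbackX, φ.pullbackY] i) P (![a, b] i) := by
    intro i; fin_cases i
    · exact hvx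
    · exact hvy
  obtain ⟨p, rfl⟩ := AdjoinRoot.mk_surjective r
  change W.HasValueAt (φ.pullbackHom (algebraMap W'.geomCoordRing W'.geomFunctionField
    (Affine.CoordinateRing.mk _ p))) P (evalAt h (Affine.CoordinateRing.mk _ p))
  set eqv := Polynomial.Bivariate.equivMvPolynomial (AlgebraicClosure K)
  rw [pullbackHom_algebraMap, pointAlgHom_mk, ← aevalAeval_eq_evalEval_map,
    ← eqv.symm_apply_apply p, aevalAeval_equivMvPolynomial_symm, evalAt_mk_equivMvPolynomial_symm]
  exact HasValueAt.aeval hw _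

/-- **`φ` maps the place at `P` to the place at `φ P`**: at a point of agreement `P`, the local ring
of `E'` at `φ P` pulls back into the local ring of `E` at `P` (`f` regular at `φ P` ⇒ `φ^* f`
regular at `P`). Silverman, *AEC*, II.§2 (e.g. Ex. 2.2: `ord_P(φ^* f) = e_φ(P) ord_{φP}(f)`).
[folklore] -/
theorem place_le_comap_pullbackHom {P : W.geomPoints}
    (hP : AgreesWithRationalMapAt W W' φ.rationalRep.P₁ φ.rationalRep.Q₁ φ.rationalRep.P₂
      φ.rationalRep.Q₂ φ P) :
    (W'.place (φ P)).toValuationSubring ≤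
      (W.place P).toValuationSubring.comap
        (φ.pullbackHom : W'.geomFunctionField →+* W.geomFunctionField) := by
  obtain ⟨hP0, hQ₁, hQ₂, h', e⟩ := agreesWithRationalMapAt_iff.mp hP
  intro z' hz'
  rw [ValuationSubring.mem_comap]
  rw [e, place_some, PlaceOver.mem_ofPrime_iff] at hz'
  set v' := maxIdealAt h'
  obtain ⟨n, d, hnd⟩ := v'.exists_primeCompl_mul_eq_of_integer z' hz'
  have hd : evalAt h' (d : W'.geomCoordRing) ≠ 0 := fun h0 ↦ d.2 ((mem_maxIdealAt_iff h' _).mpr h0)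
  have hvn := φ.hasValueAt_pullbackHom_algebraMap hP h' e n
  have hvd := φ.hasValueAt_pullbackHom_algebraMap hP h' e d
  have hd0 : φ.pullbackHom (algebraMap W'.geomCoordRing W'.geomFunctionField d) ≠ 0 :=
    hvd.ne_zero hP0 hd
  have hz'' : (φ.pullbackHom : W'.geomFunctionField →+* W.geomFunctionField) z' =
      φ.pullbackHom (algebraMap W'.geomCoordRing W'.geomFunctionField n) /
        φ.pullbackHom (algebraMap W'.geomCoordRing W'.geomFunctionField d) := by
    rw [eq_div_iff hd0, AlgHom.coe_toRingHom, ← map_mul, hnd]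
  rw [hz'']
  exact ((hvn.div hP0 hvd hd).mem_place hP0).1

/-- **The place of `K̄(E)` at a point of agreement `P` lies above the place of `K̄(E')` at `φ P`**:
`K̄[E]_P ∩ φ^* K̄(E') = φ^* K̄[E']_{φP}` (the inclusion `place_le_comap_pullbackHom` is an equality,
a discrete valuation ring being a maximal proper subring). Silverman, *AEC*, II.§2. [folklore] -/
theorem comap_pullbackHom_place {P : W.geomPoints}
    (hP : AgreesWithRationalMapAt W W' φ.rationalRep.P₁ φ.rationalRep.Q₁ φ.rationalRep.P₂
      φ.rationalRep.Q₂ φ P) :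
    (W.place P).toValuationSubring.comap
        (φ.pullbackHom : W'.geomFunctionField →+* W.geomFunctionField) =
      (W'.place (φ P)).toValuationSubring :=
  (ValuationSubring.eq_of_le_of_ne_top _ (φ.place_le_comap_pullbackHom hP)
    (φ.comap_pullbackHom_ne_top (W.place P).ne_top)).symm

end Isogeny

/-! ## `#ker φ ≤ deg_s φ`: kernel translations are automorphisms over `φ^* K̄(E')` -/

namespace Isogeny

variable [W.IsElliptic] [W'.IsElliptic] (φ : Isogeny W W')

/-- **`#ker φ ≤ deg_s φ = [K̄(E) : φ^* K̄(E')]_s`**: the translations `τ_T^*`, `T ∈ ker φ`, are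
`#ker φ` distinct automorphisms of `K̄(E)` over `φ^* K̄(E')` (the tree's `transHom_injective` and
`Isogeny.pullbackField_le_fixedField`), and a finite extension `L/F` has at most `[L : F]_s`
automorphisms (`[L : F]_s` counts the `F`-embeddings of `L` into an algebraic closure).
Silverman, *AEC*, proof of Thm. III.4.10(b) ("`#Aut(K̄(E₁)/φ^* K̄(E₂)) ≤ deg_s φ`"). [folklore] -/
theorem card_ker_le_finSepDegree :
    Nat.card φ.toAddMonoidHom.ker ≤ Field.finSepDegree φ.pullbackField W.geomFunctionField := by
  classical
  set F := φ.pullbackField with hF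
  set L := W.geomFunctionField
  haveI : FiniteDimensional F L := finiteDimensional_pullbackField_holds W W' φ
  set H : Subgroup (L ≃ₐ[AlgebraicClosure K] L) :=
    (AddSubgroup.toSubgroup φ.toAddMonoidHom.ker).map W.transHom with hH
  have hcardK : Nat.card (AddSubgroup.toSubgroup φ.toAddMonoidHom.ker) =
      Nat.card φ.toAddMonoidHom.ker :=
    Nat.card_congr (Equiv.subtypeEquiv Multiplicative.toAdd fun _ ↦ Iff.rfl)
  have hcard : Nat.card H = Nat.card φ.toAddMonoidHom.ker := by
    rw [hH, Subgroup.card_map_of_injective transHom_injective, hcardK]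
  -- `H` acts by `F`-automorphisms
  have hfix : ∀ σ : H, ∀ z : F, (σ : L ≃ₐ[AlgebraicClosure K] L) z = z := fun σ z ↦
    (IntermediateField.mem_fixedField_iff _ _).mp (φ.pullbackField_le_fixedField z.2) σ σ.2
  let toF : H → (L ≃ₐ[F] L) := fun σ ↦
    { (σ : L ≃ₐ[AlgebraicClosure K] L).toRingEquiv with
      commutes' := fun z ↦ hfix σ z }
  have htoF : Function.Injective toF := by
    intro σ τ h
    apply Subtype.ext
    apply AlgEquiv.ext
    intro z
    exact AlgEquiv.ext_iff.mp h z
  -- `F`-automorphisms are `F`-embeddings into the algebraic closure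
  let toEmb : (L ≃ₐ[F] L) → Field.Emb F L := fun σ ↦
    (IsScalarTower.toAlgHom F L (AlgebraicClosure L)).comp (σ : L →ₐ[F] L)
  have htoEmb : Function.Injective toEmb := by
    intro σ τ h
    apply AlgEquiv.ext
    intro z
    exact (algebraMap L (AlgebraicClosure L)).injective (AlgHom.ext_iff.mp h z)
  haveI : Finite (Field.Emb F L) := Fintype.finite (minpoly.AlgHom.fintype _ _ _)
  calc Nat.card φ.toAddMonoidHom.ker = Nat.card H := hcard.symm
    _ ≤ Nat.card (Field.Emb F L) := Nat.card_le_card_of_injective _ (htoEmb.comp htoF)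
    _ = Field.finSepDegree F L := rfl

end Isogeny

/-! ## `deg_s φ ≤ #ker φ`: counting places above a generic point of `E'` -/

namespace Isogeny

variable [W.IsElliptic] [W'.IsElliptic] (φ : Isogeny W W')

/-- The exceptional set of the chosen rational representation of `φ`. [folklore] -/
abbrev badSet : Set W.geomPoints :=
  {P : W.geomPoints | ¬ AgreesWithRationalMapAt W W' φ.rationalRep.P₁ φ.rationalRep.Q₁
    φ.rationalRep.P₂ φ.rationalRep.Q₂ φ P}

omit [W.IsElliptic] [W'.IsElliptic] in
/-- The exceptional set is finite. [folklore] -/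
theorem finite_badSet' : φ.badSet.Finite := φ.rationalRep.finite

/-- **`deg_s φ ≤ #ker φ`.** Let `F = φ^* K̄(E') ⊆ L = K̄(E)`. Choose `P₀ ∈ E(K̄)` outside a finite
set, so that, with `Q = φ P₀`: every point of the fibre `φ⁻¹(Q) = P₀ + ker φ` is a point of
agreement of `φ` with its rational representation; the finitely many "denominators" `B ⊆ F` of
`Literature.NumberTheory.EllipticCurves.SeparableDegreePlaces.exists_finset_card_le_places` are regular at `Q` (as functions on `E'`);
and the place of `Q` is not below the place of any exceptional point of `E`. The place `O` of `F`
below the place of `L` at `P₀` is then a valuation ring `≠ F` containing `B` with residue field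
`K̄`, so there are `deg_s φ = [L : F]_s` distinct places `𝔓ᵢ ≠ L` of `L` above `O`; each is the
place of a point `Pᵢ ∈ E(K̄)` (`place_surjective`), necessarily a point of agreement with
`φ Pᵢ = Q` (the place of `L` at `Pᵢ` lies above the place of `K̄(E')` at `φ Pᵢ`,
`comap_pullbackHom_place`, and above that at `Q`). Hence `deg_s φ ≤ #φ⁻¹(Q) = #ker φ`. This is
Silverman's deduction of Thm. III.4.10(a) from Prop. II.2.6(b) (*AEC* p. 72: "`#φ⁻¹(Q) = deg_s φ`
for all but finitely many `Q`", and all fibres are translates of `ker φ`), with II.2.6(b) in the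
form of the inequality `#φ⁻¹(Q) ≥ deg_s φ` for generic `Q`. [cite: SilvermanAEC2009, Thm. III.4.10(a) and Prop. II.2.6(b)] -/
theorem finSepDegree_le_card_ker :
    Field.finSepDegree φ.pullbackField W.geomFunctionField ≤ Nat.card φ.toAddMonoidHom.ker := by
  classical
  set F := φ.pullbackField with hF
  set L := W.geomFunctionField
  set ι : W'.geomFunctionField →+* L := (φ.pullbackHom : W'.geomFunctionField →+* L) with hι
  haveI : FiniteDimensional F L := finiteDimensional_pullbackField_holds W W' φ
  obtain ⟨B, hB⟩ := exists_finset_card_le_places.{u, u, u} (↥F) L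
  -- preimages in `K̄(E')` of the elements of `F`
  have hpre : ∀ b : F, ∃ z' : W'.geomFunctionField, φ.pullbackHom z' = b := fun b ↦
    (φ.mem_pullbackField_iff _).mp b.2
  choose pre hpre using hpre
  -- the finite set of bad base points `P₀`
  have hBad₁ : (⋃ b ∈ B, {Q : W'.geomPoints | Q ≠ 0 ∧ pre b ∉ (W'.place Q).toValuationSubring}).Finite :=
    Set.Finite.biUnion B.finite_toSet fun b _ ↦ finite_setOf_not_mem_place (pre b)
  have hBad₂ : (⋃ P ∈ φ.badSet, {Q : W'.geomPoints |
      (W'.place Q).toValuationSubring = (W.place P).toValuationSubring.comap ι}).Finite := by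
    refine Set.Finite.biUnion φ.finite_badSet' fun P _ ↦ Set.Subsingleton.finite ?_
    intro Q hQ Q' hQ'
    exact place_injective (PlaceOver.ext (hQ.trans hQ'.symm))
  have hBadP : (φ ⁻¹' ((⋃ b ∈ B, {Q : W'.geomPoints | Q ≠ 0 ∧
      pre b ∉ (W'.place Q).toValuationSubring}) ∪ (⋃ P ∈ φ.badSet, {Q : W'.geomPoints |
      (W'.place Q).toValuationSubring = (W.place P).toValuationSubring.comap ι}) ∪ {0}) ∪
      ⋃ T ∈ (φ.toAddMonoidHom.ker : Set W.geomPoints), (fun P ↦ P - T) '' φ.badSet).Finite := by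
    refine Set.Finite.union ?_ ?_
    · exact ((hBad₁.union hBad₂).union (Set.finite_singleton 0)).preimage'
        fun Q _ ↦ φ.finite_fibre Q
    · exact Set.Finite.biUnion φ.finite_ker fun T _ ↦ φ.finite_badSet'.image _
  obtain ⟨P₀, hP₀⟩ := hBadP.infinite_compl.nonempty
  set Q := φ P₀ with hQ
  -- what the choice of `P₀` buys
  have hQ0 : Q ≠ 0 := fun h0 ↦ hP₀ (Or.inl (Or.inr h0))
  have hQ1 : ∀ b ∈ B, pre b ∈ (W'.place Q).toValuationSubring := fun b hb ↦ by
    by_contra hne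
    exact hP₀ (Or.inl (Or.inl (Or.inl (Set.mem_iUnion₂.mpr ⟨b, hb, hQ0, hne⟩))))
  have hQ2 : ∀ P ∈ φ.badSet,
      (W'.place Q).toValuationSubring ≠ (W.place P).toValuationSubring.comap ι :=
    fun P hP heq ↦ hP₀ (Or.inl (Or.inl (Or.inr (Set.mem_iUnion₂.mpr ⟨P, hP, heq⟩))))
  have hgood : ∀ P : W.geomPoints, φ P = Q → P ∉ φ.badSet := by
    intro P hPQ hPbad
    refine hP₀ (Or.inr (Set.mem_iUnion₂.mpr ⟨P - P₀, ?_, P, hPbad, by abel⟩))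
    simp [hPQ, hQ]
  have hP₀good := hgood P₀ rfl
  simp only [Set.mem_setOf_eq, not_not] at hP₀good
  have hP₀ne : P₀ ≠ 0 := (agreesWithRationalMapAt_iff.mp hP₀good).1
  -- the place `O` of `F` below the place of `L` at `P₀`
  set O : ValuationSubring F := (W.place P₀).toValuationSubring.comap (algebraMap F L) with hO
  have hmemO : ∀ z : F, z ∈ O ↔ (z : L) ∈ (W.place P₀).toValuationSubring := fun z ↦ by
    rw [hO, ValuationSubring.mem_comap, IntermediateField.algebraMap_apply]
  have hOtop : O ≠ ⊤ := by
    obtain ⟨z, hzF, hz⟩ := φ.exists_mem_pullbackField_not_mem (W.place P₀).ne_top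
    intro htop
    exact hz ((hmemO ⟨z, hzF⟩).mp (htop ▸ ValuationSubring.mem_top _))
  have hP₀ι : (W.place P₀).toValuationSubring.comap ι = (W'.place Q).toValuationSubring :=
    φ.comap_pullbackHom_place hP₀good
  have hBO : (↑B : Set F) ⊆ O := by
    intro b hb
    rw [SetLike.mem_coe, hmemO, ← hpre b]
    have hbQ := hQ1 b hb
    rw [← hP₀ι, ValuationSubring.mem_comap] at hbQ
    exact hbQ
  have hcoe : ∀ c : AlgebraicClosure K,
      ((algebraMap (AlgebraicClosure K) F c : F) : L) = algebraMap (AlgebraicClosure K) L c :=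
    fun c ↦ rfl
  have hres : HasResidueField O (algebraMap (AlgebraicClosure K) F) := by
    refine ⟨fun c ↦ ?_, fun z hz ↦ ?_⟩
    · rw [hmemO, hcoe]
      exact (W.place P₀).algebraMap_mem c
    · obtain ⟨c, hc⟩ := (hasResidueField_place hP₀ne).exists_sub_mem (z : L) ((hmemO z).mp hz)
      refine ⟨c, (mem_nonunits_comap_iff (algebraMap F L).injective _ _).mpr ?_⟩
      rwa [map_sub, IntermediateField.algebraMap_apply, IntermediateField.algebraMap_apply, hcoe]
  obtain ⟨𝔓, h𝔓inj, h𝔓⟩ := hB O hOtop hBO (algebraMap (AlgebraicClosure K) F) hres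
  -- each `𝔓 i` is the place of a point of the fibre over `Q`
  have hex : ∀ i, ∃ P : W.geomPoints, φ P = Q ∧ (W.place P).toValuationSubring = 𝔓 i := by
    intro i
    obtain ⟨hne, hle⟩ := h𝔓 i
    have hK : ∀ c : AlgebraicClosure K, algebraMap (AlgebraicClosure K) L c ∈ 𝔓 i := fun c ↦ by
      have := hle (hres.mem c)
      rwa [ValuationSubring.mem_comap, IntermediateField.algebraMap_apply, hcoe] at this
    obtain ⟨𝔔, h𝔔⟩ := PlaceOver.exists_toValuationSubring_eq (𝔓 i) hne hK
    obtain ⟨P, rfl⟩ := place_surjective 𝔔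
    refine ⟨P, ?_, h𝔔⟩
    -- the place at `P` lies above the place of `K̄(E')` at `Q`
    have hcmp : (W'.place Q).toValuationSubring ≤ (W.place P).toValuationSubring.comap ι := by
      intro z' hz'
      rw [← hP₀ι, ValuationSubring.mem_comap] at hz'
      rw [ValuationSubring.mem_comap, h𝔔]
      have := hle ((hmemO ⟨ι z', φ.pullbackHom_mem z'⟩).mpr hz')
      rwa [ValuationSubring.mem_comap, IntermediateField.algebraMap_apply] at this
    by_cases hPbad : P ∈ φ.badSet
    · exact (hQ2 P hPbad (ValuationSubring.eq_of_le_of_ne_top _ hcmp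
        (φ.comap_pullbackHom_ne_top (W.place P).ne_top))).elim
    · simp only [Set.mem_setOf_eq, not_not] at hPbad
      rw [φ.comap_pullbackHom_place hPbad] at hcmp
      have heq : W'.place Q = W'.place (φ P) :=
        PlaceOver.ext (ValuationSubring.eq_of_le_of_ne_top _ hcmp (W'.place (φ P)).ne_top)
      exact (place_injective heq).symm
  choose Pt hPtQ hPt using hex
  have hPtinj : Function.Injective Pt := fun i j hij ↦ h𝔓inj (by rw [← hPt i, ← hPt j, hij])
  -- count: `i ↦ Pt i - P₀` injects `Fin (deg_s φ)` into `ker φ`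
  let f : Fin (Field.finSepDegree F L) → φ.toAddMonoidHom.ker := fun i ↦
    ⟨Pt i - P₀, by rw [AddMonoidHom.mem_ker, map_sub, coe_toAddMonoidHom, hPtQ i, hQ, sub_self]⟩
  have hf : Function.Injective f := fun i j hij ↦
    hPtinj (sub_left_injective (congrArg Subtype.val hij :))
  simpa using Nat.card_le_card_of_injective f hf

end Isogeny

/-! ## Silverman, *AEC*, Thm. III.4.10(a): `#ker φ = deg_s φ` -/

/-- **Silverman, *AEC*, Thm. III.4.10(a) (at `Q = O`): `#ker φ = deg_s φ`** for every isogeny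
`φ : E → E'` of elliptic curves over `K` — the named fact
`WeierstrassCurve.Isogeny.card_ker_eq_finSepDegree W W'` of
`Literature.NumberTheory.EllipticCurves.IsogenyDegree`, for Silverman's `deg_s φ = [K̄(E) :
φ^* K̄(E')]_s` (Mathlib's `Field.finSepDegree` of `K̄(E)` over `Isogeny.pullbackField`). The two
inequalities are `Isogeny.card_ker_le_finSepDegree` (the kernel translations are distinct
automorphisms over `φ^* K̄(E')`, proof of III.4.10(b)) and `Isogeny.finSepDegree_le_card_ker`
(places of `K̄(E)` above a generic point of `E'`, II.2.6(b), all fibres being translates of the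
kernel). [cite: SilvermanAEC2009, Thm. III.4.10(a)] -/
theorem Isogeny.card_ker_eq_finSepDegree_holds (W W' : WeierstrassCurve K) :
    Isogeny.card_ker_eq_finSepDegree W W' := by
  intro _ _ φ
  exact le_antisymm φ.card_ker_le_finSepDegree φ.finSepDegree_le_card_ker


end WeierstrassCurve
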